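import Summits.Ventures.Crystal3D.Theorems.StickyWulffConstantCoaxialWallLawSkewAxis
import HarnessLib

/-!
# Skew roots of a translation offset, IV: ALL FOUR roots of a doubly skew cubic axis and the defender's axis
# (`Σ rises ≥ √3 · sin θ'`)

HONEST FRAMING. Part of the venture `Summits/Ventures/Crystal3D` (cell `crystal3d-full`), helper
`--supports` the crux `CoaxialWallLaw` (stmt-Ventures-19481, `route-Ventures-StickyWulffConstant`),
REGISTERED line `WallLedgerF` (planner cf-p1), open stub `stub_coaxialTwoSlabAdhesion`.
RUNG CREDIT ONLY — pure lattice geometry, nothing about packings.  The multi-root form of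
`exists_skewRoot_of_axis_sine` (`…SkewAxis`, ONE root of rise `≥ sin θ'/√2`) for case (B) of the translation
trichotomy (`…SkewArithmetic`: a cubic axis `k` with all four `p_k ± p_i` non-integers): the FOUR root classes
`±(e_k ± e_i)`, `±(e_k ± e_l)` all have τ-skew orthogonal partners (`slotInt_partner`, `skew_of_axis`), and their
rising representatives carry, for EVERY orientation `A`,

`Σ_{4 roots} (A r)₂ = √2 · (max(|v_k|, |v_i|) + max(|v_k|, |v_l|)) ≥ √3 · √(1 − ⟪L' e₃, e₃⟫²)`

(`v` = cubic coordinates of `A⁻¹ e₃`, `L'` = the lattice frame of the cube vertex `sign v`, as in `…SkewAxis`).  The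
elementary inequality is `four_abs_sq_ge`: `(|a+b| + |a−b| + |a+c| + |a−c|)² ≥ 2 (3 − (|a|+|b|+|c|)²)` on the unit
sphere (cases `|a| ≤ |b| + |c|` / `|a| > |b| + |c|`); it is TIGHT at `v = e_i` (both sides `√2`), which is why no
sub-family of the four roots suffices.  With the multi-root plane-coset cell (`…PayerTransCellPlane{Export,Top,
TwoPlate}`) this gives case (B) the same census-free constant `(√6/78)·sin θ'` as twins and case (C).

* `four_abs_sq_ge`, `four_abs_ge_sine` — the real inequality and its square-root form.
* `exists_axisRoots_sine` — case (B): a root set `RT` (rising slots with τ-skew orthogonal partners) and a frame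
  `L'` of the same lattice with `√3 · √(1 − ⟪L' e₃, e₃⟫²) ≤ Σ_{r ∈ RT} (A r)₂`.

WHAT THIS IS NOT: anything about walls or packings; F-C1 not moved.
-/

noncomputable section

namespace Summit.Ventures.Crystal3D.Theorems

open Summit.Ventures.Crystal3D Finset Matrix NearIdentity
open Literature.MathematicalPhysics.StatisticalMechanics (fccStacking)
open scoped InnerProductSpace

/-! ### 1. The real inequality -/

/-- On the unit sphere: `(|a+b| + |a−b| + |a+c| + |a−c|)² ≥ 2·(3 − (|a| + |b| + |c|)²)`. -/
theorem four_abs_sq_ge {a b c : ℝ} (h : a ^ 2 + b ^ 2 + c ^ 2 = 1) :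
    2 * (3 - (|a| + |b| + |c|) ^ 2) ≤ (|a + b| + |a - b| + |a + c| + |a - c|) ^ 2 := by
  set S := |a + b| + |a - b| + |a + c| + |a - c| with hS
  have hx := abs_nonneg a
  have hy := abs_nonneg b
  have hz := abs_nonneg c
  have hsq : |a| ^ 2 + |b| ^ 2 + |c| ^ 2 = 1 := by rw [sq_abs, sq_abs, sq_abs]; exact h
  -- the four triangle inequalities
  have h1 : 2 * |a| ≤ |a + b| + |a - b| := by
    have := abs_add_le (a + b) (a - b)
    rw [show a + b + (a - b) = 2 * a by ring, abs_mul, abs_two] at this; exact this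
  have h2 : 2 * |b| ≤ |a + b| + |a - b| := by
    have := abs_sub (a + b) (a - b)
    rw [show a + b - (a - b) = 2 * b by ring, abs_mul, abs_two] at this; exact this
  have h3 : 2 * |a| ≤ |a + c| + |a - c| := by
    have := abs_add_le (a + c) (a - c)
    rw [show a + c + (a - c) = 2 * a by ring, abs_mul, abs_two] at this; exact this
  have h4 : 2 * |c| ≤ |a + c| + |a - c| := by
    have := abs_sub (a + c) (a - c)
    rw [show a + c - (a - c) = 2 * c by ring, abs_mul, abs_two] at this; exact this
  have hS0 : 0 ≤ S := by positivity
  by_cases hcase : |a| ≤ |b| + |c|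
  · -- `S ≥ 2(|b| + |c|)` and `4(|b|+|c|)² + 2(|a|+|b|+|c|)² − 6 = 4|a|(|b|+|c|−|a|) + 12|b||c| ≥ 0`
    have hSge : 2 * (|b| + |c|) ≤ S := by rw [hS]; linarith
    have hSsq : (2 * (|b| + |c|)) ^ 2 ≤ S ^ 2 := pow_le_pow_left₀ (by positivity) hSge 2
    nlinarith [mul_nonneg hx (sub_nonneg.2 hcase), mul_nonneg hy hz]
  · -- `S ≥ 4|a|` and `|a| > |b| + |c|`
    push Not at hcase
    have hSge : 4 * |a| ≤ S := by rw [hS]; linarith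
    have hSsq : (4 * |a|) ^ 2 ≤ S ^ 2 := pow_le_pow_left₀ (by positivity) hSge 2
    have hbc : (|b| + |c|) ^ 2 ≤ |a| ^ 2 := pow_le_pow_left₀ (by positivity) hcase.le 2
    nlinarith [mul_nonneg hy hz]

/-- The square-root form: `√3 · √(1 − κ²(|a|+|b|+|c|)²) ≤ (|a+b| + |a−b| + |a+c| + |a−c|)/√2` for `3κ² = 1`. -/
theorem four_abs_ge_sine {a b c κ : ℝ} (h : a ^ 2 + b ^ 2 + c ^ 2 = 1) (hκ : 3 * κ ^ 2 = 1) :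
    Real.sqrt 3 * Real.sqrt (1 - (κ * (|a| + |b| + |c|)) ^ 2) ≤
      (|a + b| + |a - b| + |a + c| + |a - c|) / Real.sqrt 2 := by
  set S := |a + b| + |a - b| + |a + c| + |a - c| with hS
  have hS0 : 0 ≤ S := by positivity
  have hs2 : 0 < Real.sqrt 2 := by positivity
  have hsq2 : Real.sqrt 2 ^ 2 = 2 := Real.sq_sqrt (by norm_num)
  have hkey : 3 * (1 - (κ * (|a| + |b| + |c|)) ^ 2) ≤ (S / Real.sqrt 2) ^ 2 := by
    rw [div_pow, hsq2, mul_pow, show κ ^ 2 = 1 / 3 by linarith]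
    have := four_abs_sq_ge h
    rw [← hS] at this
    linarith
  rw [← Real.sqrt_mul (by norm_num : (0 : ℝ) ≤ 3),
    show S / Real.sqrt 2 = Real.sqrt ((S / Real.sqrt 2) ^ 2) by rw [Real.sqrt_sq (by positivity)]]
  exact Real.sqrt_le_sqrt hkey

/-! ### 2. Case (B): all four roots -/

/-- Table: the other two axes `I k`, `L k` of a cubic axis `k`, the four roots `e_k + e_I`, `e_k − e_I`,
`e_k + e_L`, `e_k − e_L` (slot indices `T₁ k … T₄ k`) and their negatives (`N₁ k … N₄ k`), with their cubic
entries — kernel-decided. -/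
theorem axisRoots_table : ∀ k : Fin 3,
    (![1, 0, 0] : Fin 3 → Fin 3) k ≠ k ∧ (![2, 2, 1] : Fin 3 → Fin 3) k ≠ k ∧
    (![1, 0, 0] : Fin 3 → Fin 3) k ≠ (![2, 2, 1] : Fin 3 → Fin 3) k ∧
    -- entries (axis k, axis I, axis L) of T₁..T₄
    (slotInt ((![0, 0, 4] : Fin 3 → Fin 12) k) k = 1 ∧ slotInt ((![0, 0, 4] : Fin 3 → Fin 12) k) ((![1, 0, 0] : Fin 3 → Fin 3) k) = 1 ∧
      slotInt ((![0, 0, 4] : Fin 3 → Fin 12) k) ((![2, 2, 1] : Fin 3 → Fin 3) k) = 0) ∧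
    (slotInt ((![1, 2, 6] : Fin 3 → Fin 12) k) k = 1 ∧ slotInt ((![1, 2, 6] : Fin 3 → Fin 12) k) ((![1, 0, 0] : Fin 3 → Fin 3) k) = -1 ∧
      slotInt ((![1, 2, 6] : Fin 3 → Fin 12) k) ((![2, 2, 1] : Fin 3 → Fin 3) k) = 0) ∧
    (slotInt ((![4, 8, 8] : Fin 3 → Fin 12) k) k = 1 ∧ slotInt ((![4, 8, 8] : Fin 3 → Fin 12) k) ((![1, 0, 0] : Fin 3 → Fin 3) k) = 0 ∧
      slotInt ((![4, 8, 8] : Fin 3 → Fin 12) k) ((![2, 2, 1] : Fin 3 → Fin 3) k) = 1) ∧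
    (slotInt ((![5, 9, 10] : Fin 3 → Fin 12) k) k = 1 ∧ slotInt ((![5, 9, 10] : Fin 3 → Fin 12) k) ((![1, 0, 0] : Fin 3 → Fin 3) k) = 0 ∧
      slotInt ((![5, 9, 10] : Fin 3 → Fin 12) k) ((![2, 2, 1] : Fin 3 → Fin 3) k) = -1) ∧
    -- the negatives N₁..N₄, entrywise
    (∀ j : Fin 3, slotInt ((![3, 3, 7] : Fin 3 → Fin 12) k) j = -slotInt ((![0, 0, 4] : Fin 3 → Fin 12) k) j) ∧
    (∀ j : Fin 3, slotInt ((![2, 1, 5] : Fin 3 → Fin 12) k) j = -slotInt ((![1, 2, 6] : Fin 3 → Fin 12) k) j) ∧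
    (∀ j : Fin 3, slotInt ((![7, 11, 11] : Fin 3 → Fin 12) k) j = -slotInt ((![4, 8, 8] : Fin 3 → Fin 12) k) j) ∧
    (∀ j : Fin 3, slotInt ((![6, 10, 9] : Fin 3 → Fin 12) k) j = -slotInt ((![5, 9, 10] : Fin 3 → Fin 12) k) j) := by
  decide

/-- Table: the eight slot indices of `axisRoots_table` are pairwise distinct across the four root classes. -/
theorem axisRoots_distinct : ∀ k : Fin 3,
    ((![0, 0, 4] : Fin 3 → Fin 12) k ≠ (![1, 2, 6] : Fin 3 → Fin 12) k ∧ (![0, 0, 4] : Fin 3 → Fin 12) k ≠ (![2, 1, 5] : Fin 3 → Fin 12) k ∧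
      (![3, 3, 7] : Fin 3 → Fin 12) k ≠ (![1, 2, 6] : Fin 3 → Fin 12) k ∧ (![3, 3, 7] : Fin 3 → Fin 12) k ≠ (![2, 1, 5] : Fin 3 → Fin 12) k) ∧
    ((![0, 0, 4] : Fin 3 → Fin 12) k ≠ (![4, 8, 8] : Fin 3 → Fin 12) k ∧ (![0, 0, 4] : Fin 3 → Fin 12) k ≠ (![7, 11, 11] : Fin 3 → Fin 12) k ∧
      (![3, 3, 7] : Fin 3 → Fin 12) k ≠ (![4, 8, 8] : Fin 3 → Fin 12) k ∧ (![3, 3, 7] : Fin 3 → Fin 12) k ≠ (![7, 11, 11] : Fin 3 → Fin 12) k) ∧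
    ((![0, 0, 4] : Fin 3 → Fin 12) k ≠ (![5, 9, 10] : Fin 3 → Fin 12) k ∧ (![0, 0, 4] : Fin 3 → Fin 12) k ≠ (![6, 10, 9] : Fin 3 → Fin 12) k ∧
      (![3, 3, 7] : Fin 3 → Fin 12) k ≠ (![5, 9, 10] : Fin 3 → Fin 12) k ∧ (![3, 3, 7] : Fin 3 → Fin 12) k ≠ (![6, 10, 9] : Fin 3 → Fin 12) k) ∧
    ((![1, 2, 6] : Fin 3 → Fin 12) k ≠ (![4, 8, 8] : Fin 3 → Fin 12) k ∧ (![1, 2, 6] : Fin 3 → Fin 12) k ≠ (![7, 11, 11] : Fin 3 → Fin 12) k ∧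
      (![2, 1, 5] : Fin 3 → Fin 12) k ≠ (![4, 8, 8] : Fin 3 → Fin 12) k ∧ (![2, 1, 5] : Fin 3 → Fin 12) k ≠ (![7, 11, 11] : Fin 3 → Fin 12) k) ∧
    ((![1, 2, 6] : Fin 3 → Fin 12) k ≠ (![5, 9, 10] : Fin 3 → Fin 12) k ∧ (![1, 2, 6] : Fin 3 → Fin 12) k ≠ (![6, 10, 9] : Fin 3 → Fin 12) k ∧
      (![2, 1, 5] : Fin 3 → Fin 12) k ≠ (![5, 9, 10] : Fin 3 → Fin 12) k ∧ (![2, 1, 5] : Fin 3 → Fin 12) k ≠ (![6, 10, 9] : Fin 3 → Fin 12) k) ∧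
    ((![4, 8, 8] : Fin 3 → Fin 12) k ≠ (![5, 9, 10] : Fin 3 → Fin 12) k ∧ (![4, 8, 8] : Fin 3 → Fin 12) k ≠ (![6, 10, 9] : Fin 3 → Fin 12) k ∧
      (![7, 11, 11] : Fin 3 → Fin 12) k ≠ (![5, 9, 10] : Fin 3 → Fin 12) k ∧ (![7, 11, 11] : Fin 3 → Fin 12) k ≠ (![6, 10, 9] : Fin 3 → Fin 12) k) := by
  decide

/-- **Case (B), all four roots, with the defender's axis.**  If all four `p_k ± p_i` (`i ≠ k`) are
non-integers (`p = √2 · cubicCoords τ`), then for every orientation `A` there are a set `RT` of RISING slots,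
each with a τ-skew orthogonal slot, and a frame `L'` of the same lattice (`L'·Λ₀ = A·Λ₀`) with
`√3 · √(1 − ⟪L' e₃, e₃⟫²) ≤ Σ_{r ∈ RT} (A r)₂`. -/
theorem exists_axisRoots_sine (τ : EuclideanSpace ℝ (Fin 3)) (k : Fin 3)
    (hk : ∀ i : Fin 3, i ≠ k →
      (¬ ∃ z : ℤ, Real.sqrt 2 * cubicCoords τ k + Real.sqrt 2 * cubicCoords τ i = z) ∧
      (¬ ∃ z : ℤ, Real.sqrt 2 * cubicCoords τ k - Real.sqrt 2 * cubicCoords τ i = z))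
    (A : EuclideanSpace ℝ (Fin 3) ≃ₗᵢ[ℝ] EuclideanSpace ℝ (Fin 3)) :
    ∃ RT : Finset (EuclideanSpace ℝ (Fin 3)), (∀ r ∈ RT, r ∈ fccSlots ∧ 0 < (A r) 2) ∧
      (∀ r ∈ RT, ∃ s ∈ fccSlots, ⟪r, s⟫_ℝ = 0 ∧ ∀ z : ℤ, ⟪τ, s⟫_ℝ ≠ (z : ℝ) / 2) ∧
      ∃ L' : EuclideanSpace ℝ (Fin 3) ≃ₗᵢ[ℝ] EuclideanSpace ℝ (Fin 3),
        L' '' fccStacking 1 (Real.sqrt (2 / 3)) = A '' fccStacking 1 (Real.sqrt (2 / 3)) ∧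
        Real.sqrt 3 * Real.sqrt (1 - ⟪L' (EuclideanSpace.single (2 : Fin 3) (1 : ℝ)),
            EuclideanSpace.single (2 : Fin 3) (1 : ℝ)⟫_ℝ ^ 2) ≤ ∑ r ∈ RT, (A r) 2 := by
  classical
  have hadj : ∀ x y : EuclideanSpace ℝ (Fin 3), ⟪A x, y⟫_ℝ = ⟪x, A.symm y⟫_ℝ := fun x y => by
    rw [← A.inner_map_map x (A.symm y), A.apply_symm_apply]
  have hv1 := sum_sq_cubicCoords_symm_e₃ A
  set v := cubicCoords (A.symm (EuclideanSpace.single (2 : Fin 3) (1 : ℝ))) with hv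
  -- the sign vector of `v` and its lattice frame (as in `exists_skewRoot_of_axis_sine`)
  obtain ⟨c, hc0, hc1, hc2⟩ := exists_cubeInt_eq (if 0 ≤ v 0 then 1 else -1) (if 0 ≤ v 1 then 1 else -1)
    (if 0 ≤ v 2 then 1 else -1) (by split_ifs <;> simp) (by split_ifs <;> simp) (by split_ifs <;> simp)
  have hcabs : ∀ j : Fin 3, (cubeInt c j : ℝ) * v j = |v j| := by
    intro j
    fin_cases j <;> simp only [Fin.isValue, Fin.zero_eta, Fin.mk_one, Fin.reduceFinMk]
    · rw [hc0]; split_ifs with h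
      · rw [abs_of_nonneg h, one_mul]
      · rw [abs_of_neg (lt_of_not_ge h)]; ring
    · rw [hc1]; split_ifs with h
      · rw [abs_of_nonneg h, one_mul]
      · rw [abs_of_neg (lt_of_not_ge h)]; ring
    · rw [hc2]; split_ifs with h
      · rw [abs_of_nonneg h, one_mul]
      · rw [abs_of_neg (lt_of_not_ge h)]; ring
  obtain ⟨G, hG, κ, hκ, hcoord⟩ := exists_latticeFrame_of_cube c
  have hκ2 : 3 * κ ^ 2 = 1 := by
    have hn := norm_sq_eq_cubicCoords (G (EuclideanSpace.single (2 : Fin 3) (1 : ℝ)))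
    rw [LinearIsometryEquiv.norm_map, PiLp.norm_single, norm_one, one_pow] at hn
    simp only [dotProduct, Fin.sum_univ_three] at hn
    rw [hcoord 0, hcoord 1, hcoord 2] at hn
    have h0 := cubeInt_pm_one c 0
    have h1 := cubeInt_pm_one c 1
    have h2 := cubeInt_pm_one c 2
    have e0 : ((cubeInt c 0 : ℝ)) ^ 2 = 1 := by rcases h0 with h | h <;> rw [h] <;> norm_num
    have e1 : ((cubeInt c 1 : ℝ)) ^ 2 = 1 := by rcases h1 with h | h <;> rw [h] <;> norm_num
    have e2 : ((cubeInt c 2 : ℝ)) ^ 2 = 1 := by rcases h2 with h | h <;> rw [h] <;> norm_num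
    have e : (1 : ℝ) = κ ^ 2 * ((cubeInt c 0 : ℝ) ^ 2 + (cubeInt c 1 : ℝ) ^ 2 + (cubeInt c 2 : ℝ) ^ 2) := by
      rw [hn]; ring
    rw [e0, e1, e2] at e
    linarith
  have hinner : ⟪(G.trans A) (EuclideanSpace.single (2 : Fin 3) (1 : ℝ)),
      EuclideanSpace.single (2 : Fin 3) (1 : ℝ)⟫_ℝ = κ * (|v 0| + |v 1| + |v 2|) := by
    rw [LinearIsometryEquiv.trans_apply, hadj, inner_eq_cubicCoords, ← hv]
    simp only [dotProduct, Fin.sum_univ_three]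
    rw [hcoord 0, hcoord 1, hcoord 2, ← hcabs 0, ← hcabs 1, ← hcabs 2]; ring
  -- the table
  obtain ⟨hik, hlk, hil, ⟨hT₁k, hT₁i, hT₁l⟩, ⟨hT₂k, hT₂i, hT₂l⟩, ⟨hT₃k, hT₃i, hT₃l⟩, ⟨hT₄k, hT₄i, hT₄l⟩,
    hN₁, hN₂, hN₃, hN₄⟩ := axisRoots_table k
  set i : Fin 3 := (![1, 0, 0] : Fin 3 → Fin 3) k with hidef
  set l : Fin 3 := (![2, 2, 1] : Fin 3 → Fin 3) k with hldef
  set T₁ : Fin 12 := (![0, 0, 4] : Fin 3 → Fin 12) k with hT₁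
  set T₂ : Fin 12 := (![1, 2, 6] : Fin 3 → Fin 12) k with hT₂
  set T₃ : Fin 12 := (![4, 8, 8] : Fin 3 → Fin 12) k with hT₃
  set T₄ : Fin 12 := (![5, 9, 10] : Fin 3 → Fin 12) k with hT₄
  set N₁ : Fin 12 := (![3, 3, 7] : Fin 3 → Fin 12) k with hN₁def
  set N₂ : Fin 12 := (![2, 1, 5] : Fin 3 → Fin 12) k with hN₂def
  set N₃ : Fin 12 := (![7, 11, 11] : Fin 3 → Fin 12) k with hN₃def
  set N₄ : Fin 12 := (![6, 10, 9] : Fin 3 → Fin 12) k with hN₄def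
  have hsq : v k ^ 2 + v i ^ 2 + v l ^ 2 = 1 := by
    rw [← sum_three_perm (fun j => v j ^ 2) k i l hik hlk hil]; exact hv1
  -- the rise of a slot from its cubic entries
  have hrise : ∀ m : Fin 12, (A (slotSite m)) 2 =
      ((slotInt m k : ℝ) * v k + (slotInt m i : ℝ) * v i + (slotInt m l : ℝ) * v l) / Real.sqrt 2 := by
    intro m
    rw [apply_two_slotSite, ← hv]
    simp only [dotProduct, slotVec, Fin.sum_univ_three]
    have := sum_three_perm (fun j => (slotInt m j : ℝ) / Real.sqrt 2 * v j) k i l hik hlk hil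
    rw [this]; ring
  have hriseN : ∀ m m' : Fin 12, (∀ j : Fin 3, slotInt m' j = -slotInt m j) →
      (A (slotSite m')) 2 = -(A (slotSite m)) 2 := by
    intro m m' hmm'
    rw [hrise, hrise, hmm' k, hmm' i, hmm' l]; push_cast; ring
  -- the four rises
  set x₁ : ℝ := (v k + v i) / Real.sqrt 2 with hx₁
  set x₂ : ℝ := (v k - v i) / Real.sqrt 2 with hx₂
  set x₃ : ℝ := (v k + v l) / Real.sqrt 2 with hx₃
  set x₄ : ℝ := (v k - v l) / Real.sqrt 2 with hx₄
  have hxT₁ : (A (slotSite T₁)) 2 = x₁ := by rw [hrise, hT₁k, hT₁i, hT₁l]; push_cast; rw [hx₁]; ring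
  have hxT₂ : (A (slotSite T₂)) 2 = x₂ := by rw [hrise, hT₂k, hT₂i, hT₂l]; push_cast; rw [hx₂]; ring
  have hxT₃ : (A (slotSite T₃)) 2 = x₃ := by rw [hrise, hT₃k, hT₃i, hT₃l]; push_cast; rw [hx₃]; ring
  have hxT₄ : (A (slotSite T₄)) 2 = x₄ := by rw [hrise, hT₄k, hT₄i, hT₄l]; push_cast; rw [hx₄]; ring
  have hxN₁ : (A (slotSite N₁)) 2 = -x₁ := by rw [hriseN T₁ N₁ hN₁, hxT₁]
  have hxN₂ : (A (slotSite N₂)) 2 = -x₂ := by rw [hriseN T₂ N₂ hN₂, hxT₂]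
  have hxN₃ : (A (slotSite N₃)) 2 = -x₃ := by rw [hriseN T₃ N₃ hN₃, hxT₃]
  have hxN₄ : (A (slotSite N₄)) 2 = -x₄ := by rw [hriseN T₄ N₄ hN₄, hxT₄]
  -- the rising representatives (slot indices)
  set ρ₁ : Fin 12 := if 0 ≤ x₁ then T₁ else N₁ with hρ₁
  set ρ₂ : Fin 12 := if 0 ≤ x₂ then T₂ else N₂ with hρ₂
  set ρ₃ : Fin 12 := if 0 ≤ x₃ then T₃ else N₃ with hρ₃
  set ρ₄ : Fin 12 := if 0 ≤ x₄ then T₄ else N₄ with hρ₄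
  have habs : ∀ (x : ℝ) (T N ρ : Fin 12), ρ = (if 0 ≤ x then T else N) → (A (slotSite T)) 2 = x →
      (A (slotSite N)) 2 = -x → (A (slotSite ρ)) 2 = |x| := by
    intro x T N ρ hρ hT hN
    by_cases h0 : 0 ≤ x
    · rw [hρ, if_pos h0, hT, abs_of_nonneg h0]
    · rw [hρ, if_neg h0, hN, abs_of_neg (lt_of_not_ge h0)]
  have ha₁ := habs x₁ T₁ N₁ ρ₁ hρ₁ hxT₁ hxN₁
  have ha₂ := habs x₂ T₂ N₂ ρ₂ hρ₂ hxT₂ hxN₂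
  have ha₃ := habs x₃ T₃ N₃ ρ₃ hρ₃ hxT₃ hxN₃
  have ha₄ := habs x₄ T₄ N₄ ρ₄ hρ₄ hxT₄ hxN₄
  -- the representatives have a non-zero `k`-entry (so their partners are skew)
  have hkne : ∀ (x : ℝ) (T N ρ : Fin 12), ρ = (if 0 ≤ x then T else N) → slotInt T k = 1 →
      (∀ j : Fin 3, slotInt N j = -slotInt T j) → slotInt ρ k ≠ 0 := by
    intro x T N ρ hρ hT hN
    by_cases h0 : 0 ≤ x
    · rw [hρ, if_pos h0, hT]; decide
    · rw [hρ, if_neg h0, hN k, hT]; decide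
  have hk₁ := hkne x₁ T₁ N₁ ρ₁ hρ₁ hT₁k hN₁
  have hk₂ := hkne x₂ T₂ N₂ ρ₂ hρ₂ hT₂k hN₂
  have hk₃ := hkne x₃ T₃ N₃ ρ₃ hρ₃ hT₃k hN₃
  have hk₄ := hkne x₄ T₄ N₄ ρ₄ hρ₄ hT₄k hN₄
  -- pairwise distinct
  obtain ⟨hD12, hD13, hD14, hD23, hD24, hD34⟩ := axisRoots_distinct k
  have hneρ : ∀ (x y : ℝ) (T N T' N' : Fin 12), (T ≠ T' ∧ T ≠ N' ∧ N ≠ T' ∧ N ≠ N') →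
      (if 0 ≤ x then T else N) ≠ (if 0 ≤ y then T' else N') := by
    rintro x y T N T' N' ⟨h1, h2, h3, h4⟩
    split_ifs <;> assumption
  have hd12 : ρ₁ ≠ ρ₂ := by rw [hρ₁, hρ₂]; exact hneρ x₁ x₂ T₁ N₁ T₂ N₂ hD12
  have hd13 : ρ₁ ≠ ρ₃ := by rw [hρ₁, hρ₃]; exact hneρ x₁ x₃ T₁ N₁ T₃ N₃ hD13
  have hd14 : ρ₁ ≠ ρ₄ := by rw [hρ₁, hρ₄]; exact hneρ x₁ x₄ T₁ N₁ T₄ N₄ hD14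
  have hd23 : ρ₂ ≠ ρ₃ := by rw [hρ₂, hρ₃]; exact hneρ x₂ x₃ T₂ N₂ T₃ N₃ hD23
  have hd24 : ρ₂ ≠ ρ₄ := by rw [hρ₂, hρ₄]; exact hneρ x₂ x₄ T₂ N₂ T₄ N₄ hD24
  have hd34 : ρ₃ ≠ ρ₄ := by rw [hρ₃, hρ₄]; exact hneρ x₃ x₄ T₃ N₃ T₄ N₄ hD34
  have hsd : ∀ {a b : Fin 12}, a ≠ b → slotSite a ≠ slotSite b := fun h h' => h (slotSite_injective h')
  -- the root set
  set RT : Finset (EuclideanSpace ℝ (Fin 3)) :=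
    ({slotSite ρ₁, slotSite ρ₂, slotSite ρ₃, slotSite ρ₄} : Finset _).filter fun r => 0 < (A r) 2 with hRTdef
  refine ⟨RT, ?_, ?_, G.trans A, by rw [LinearIsometryEquiv.coe_trans, Set.image_comp, hG], ?_⟩
  · -- slots, rising
    intro r hr
    obtain ⟨hr', hpos⟩ := mem_filter.1 hr
    simp only [mem_insert, mem_singleton] at hr'
    rcases hr' with rfl | rfl | rfl | rfl <;> exact ⟨slotSite_mem _, hpos⟩
  · -- skew partners
    intro r hr
    obtain ⟨hr', -⟩ := mem_filter.1 hr
    simp only [mem_insert, mem_singleton] at hr'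
    have hpart : ∀ ρ : Fin 12, slotInt ρ k ≠ 0 →
        ∃ s ∈ fccSlots, ⟪slotSite ρ, s⟫_ℝ = 0 ∧ ∀ z : ℤ, ⟪τ, s⟫_ℝ ≠ (z : ℝ) / 2 := by
      intro ρ hρk
      obtain ⟨m', hmm', hsupp⟩ := slotInt_partner ρ
      exact ⟨slotSite m', slotSite_mem m', by rw [inner_slotSite, hmm']; simp, skew_of_axis τ k hk m' (hsupp k hρk)⟩
    rcases hr' with rfl | rfl | rfl | rfl
    · exact hpart ρ₁ hk₁
    · exact hpart ρ₂ hk₂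
    · exact hpart ρ₃ hk₃
    · exact hpart ρ₄ hk₄
  · -- the flux
    rw [hinner]
    have habs' : |v 0| + |v 1| + |v 2| = |v k| + |v i| + |v l| := sum_three_perm (fun j => |v j|) k i l hik hlk hil
    have hfour := four_abs_ge_sine (κ := κ) hsq hκ2
    rw [← habs'] at hfour
    refine hfour.trans (le_of_eq ?_)
    -- `Σ_{RT} (A r)₂ = |x₁| + |x₂| + |x₃| + |x₄|`
    have hsum : ∑ r ∈ RT, (A r) 2 = |x₁| + |x₂| + |x₃| + |x₄| := by
      rw [hRTdef, sum_filter, sum_insert (by simp [hsd hd12, hsd hd13, hsd hd14]),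
        sum_insert (by simp [hsd hd23, hsd hd24]), sum_insert (by simp [hsd hd34]), sum_singleton,
        ha₁, ha₂, ha₃, ha₄]
      have e : ∀ y : ℝ, (if 0 < |y| then |y| else 0) = |y| := by
        intro y
        by_cases h : 0 < |y|
        · rw [if_pos h]
        · rw [if_neg h]; have := abs_nonneg y; linarith
      rw [e, e, e, e]; ring
    rw [hsum, hx₁, hx₂, hx₃, hx₄, abs_div, abs_div, abs_div, abs_div,
      abs_of_pos (Real.sqrt_pos.2 (by norm_num : (0:ℝ) < 2))]
    ring

end Summit.Ventures.Crystal3D.Theorems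

end
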